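import Summits.ResolutionOfSingularities.ResolutionOfSingularities.Theorems.FrobeniusClosingPatchingRelPerfectMonomialPolyhedraGameFreeWin
import Summits.ResolutionOfSingularities.ResolutionOfSingularities.Theorems.FrobeniusClosingPatchingRelPerfectMonomialRungOfGame
import HarnessLib

/-!
# Crux `PatchingRelPerfect` (stmt-ResolutionOfSingularities-16161), chain w52 — TargetsF3 (m):
# M2 AND THE MONOMIAL RUNG R-mono GENERAL, CLOSED FACT-FREE (ROUTE F)

[OURS · L1 W5.2 · rung ledger: R-mono GENERAL; res-L1-w52-stub-4 g3 ROUTE-F; fact-free; nothing here is a statement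
of the manuscript under review]

With `PolyhedraGame.globalPermissiblePolyhedraGame_holds` (file F5b, the combinatorial half, ROUTE F) the two
closers of the scheme dictionary become unconditional:

* **`DepthTargets.monomialSumPrincipalization_holds : DepthTargets.MonomialSumPrincipalization`** (target M2 of
  `…MonomialRungTargets.lean`: every finite sum of monomial ideals on a simple normal crossings boundary of a Noetherian
  regular scheme is principalised by blow-ups of regular strata OVER ITS COSUPPORT, with regular top) — via
  `MonomialCleanup.monomialSumPrincipalization_of_game` (p511810);
* **`DepthTargets.monomialConclusion_holds : DepthTargets.MonomialConclusion`** (R-mono: every `𝔪`-primary MONOMIAL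
  ideal of a regular local ring of any dimension and characteristic has an `𝔪`-primary companion `Q` with
  `Bl_{I·Q}` regular) — via `MonomialCleanup.monomialConclusion_of_game` (p512719: M1 `monomialFormat_holds`, M2, M3
  `closedPointTower_holds`, D5 `towerContraction_holds`).

No printed fact is used anywhere on the path (kernel axioms only).

## References

* J. Kollár, *Lectures on Resolution of Singularities* (2007), (3.111) Step 3. [Kollar2007]
-/

-- `Summit.<Summit>.<Sub>.Theorems` with `Sub = Summit` (single-conjunct summit, D-0017)
set_option linter.dupNamespace false

noncomputable section

namespace Summit.ResolutionOfSingularities.ResolutionOfSingularities.Theorems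

universe u

/-- [OURS · W5.2 F3 · M2 CLOSED] **Every finite sum of monomial ideals on a simple normal crossings boundary of a
Noetherian regular scheme is principalised by blowing up regular strata over its cosupport** (target M2, all
dimensions and characteristics, fact-free). [cite: Kollar2007, (3.111) Step 3] -/
theorem DepthTargets.monomialSumPrincipalization_holds : DepthTargets.MonomialSumPrincipalization.{u} :=
  MonomialCleanup.monomialSumPrincipalization_of_game PolyhedraGame.globalPermissiblePolyhedraGame_holds

/-- [OURS · W5.2 F3 · RUNG R-mono GENERAL CLOSED] **Every `𝔪`-primary monomial ideal of a regular local ring has an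
`𝔪`-primary companion `Q` with `Bl_{I·Q}` regular** (`DepthTargets.MonomialConclusion`; any dimension, any
characteristic, any residue field; fact-free). [cite: Kollar2007, (3.111) Step 3] -/
theorem DepthTargets.monomialConclusion_holds : DepthTargets.MonomialConclusion.{u} :=
  MonomialCleanup.monomialConclusion_of_game PolyhedraGame.globalPermissiblePolyhedraGame_holds

end Summit.ResolutionOfSingularities.ResolutionOfSingularities.Theorems

end
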